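import Literature.Probability.LatticeModels.CoarseCellMixingPeierls

/-!
# Line `local-ac-open-certificate` for the crux `RobustYangMills` (stmt-QuantumFields-13897) —
# the honest engine of reshape r3 and the CLOSED stub `stub_engineOfAnnealed`

Crux: `Summit.QuantumFields.QCD.Theses.NestedDissectionSea.RobustYangMills`; checked skeleton
`Cruxes/RobustYangMills/Lines/local-ac-open-certificate.lean` (reshape r3); companion modules
`NestedDissectionSeaRobustYangMillsLocalAC` (§0–§1, `stub_localAC`) and
`NestedDissectionSeaRobustYangMillsStubDeployment` (§2–§3 of reshape r2, `stub_deployment`).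

Reshape r3 replaces the typed engine `PerturbedMixingEngine` of reshape r2 (Peierls rarity of bad
cells under the reference MEASURE `ν₀` does not transfer to the perturbed measure by any
volume-local argument) by two Props over the Literature coarse-cell vocabulary
(`CoarseCellFiniteSize`, `CoarseCellMixingPeierls`), carried here verbatim from the skeleton:

* `PerturbedMixingEngineUKP` — the engine with ONE extra binder, the kernel-uniform Peierls bound
  `UniformKernelPeierls cell γ₀ good p` for the REFERENCE KERNELS (uniform in the volume and in the
  boundary condition away from boundary defects), spliced in after `PeierlsRare good ν₀ p`;
* `AnnealedEngine` — the classical one-specification mixing theorem with Peierls-rare defects and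
  a leak (van den Berg–Maes / Dobrushin–Shlosman; statement of the OPEN stub `stub_annealedEngine`).

**Theorem `stub_engineOfAnnealed : AnnealedEngine → PerturbedMixingEngineUKP`** (CLOSED here).
Proof: thresholds `ε₁(n) = log(1 + 1/(8·shellCount 4 n))/(4n+1)⁴` (so that the perturbed
finite-size threshold `ε = ε₀ + 1/(4·shellCount 4 n)` of `isGoodFS_of_isLocallyAC` has
`ε·shellCount ≤ 3/4`) and `p₀ = q₀ e^{-81 ε₁}` (so that the perturbed kernels satisfy the uniform
Peierls bound at level `e^{81 ε₁} p ≤ q₀`, `kernel_allBad_le_of_uniformKernelPeierls`); the annealed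
engine then bounds the averaged boundary influence `∫ |γ_Λ f' - ν f'| dν` of the rescaled
observable `f' = (f/B_f + 1)/2 ∈ [0,1]` with `Λ :=` the sites whose cell is not in `Δg`, and the
DLR covariance identity (`abs_covariance_le_integral_abs`, `integral_abs_kernel_sub_rescale`)
turns it into `|cov_ν(f,g)| ≤ 2C B_f B_g |Δf| |Δg| e^{-κₑ D}`.

Sources: Georgii (2011) §8.2 and Rem. 1.24; van den Berg–Maes, Ann. Probab. 22 (1994) §2;
Dobrushin–Shlosman (1985) §2.
-/

set_option autoImplicit false

noncomputable section

namespace Summit.QuantumFields.QCD.Cruxes.RobustYangMills.LocalAcOpenCertificate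

open scoped BigOperators ENNReal
open MeasureTheory
open Literature.Probability.LatticeModels (CoarseIdx cdist shellCount cellCount IsGoodFS HasLeak
  IsLocallyAC PeierlsRare UniformKernelPeierls Specification IsSpecification IsGibbsMeasure
  one_le_shellCount isGoodFS_of_isLocallyAC kernel_allBad_le_of_uniformKernelPeierls
  peierlsRare_of_uniformKernelPeierls abs_covariance_le_integral_abs integral_abs_kernel_sub_rescale)

/-! ## §2′ The engine with the kernel-uniform Peierls datum and the annealed engine (reshape r3) -/

/-- **The engine with the kernel-uniform Peierls datum** (reshape r3): for every window `n ≥ 1`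
thresholds `p₀(n), ε₁(n) > 0`, and for every `(ε₀, r)` constants `Λ₀, κₑ > 0`, `C₀ ≥ 0`, such
that a specification `γ` locally a.c. at rate `ε₁` w.r.t. a reference `γ₀` with the good-exterior
finite-size condition `(n, ε₀)`, both with leak profile `(Λl ≤ Λ₀, r)`, bad cells Peierls-rare
under the reference Gibbs measure AND under the reference KERNELS uniformly in volume and boundary
condition (`UniformKernelPeierls cell γ₀ good p`, `p ≤ p₀`), on a coarse 4-torus with `≥ 4n+3`
cells per axis, has covariance decay `C₀ B_f B_g |Δf| |Δg| e^{-κₑ D}` for every Gibbs measure. -/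
def PerturbedMixingEngineUKP : Prop :=
  ∀ n : ℕ, 1 ≤ n → ∃ p₀ ε₁ : ℝ, 0 < p₀ ∧ 0 < ε₁ ∧
    ∀ (ε₀ r : ℝ), 0 ≤ ε₀ → 2 * ε₀ * (shellCount 4 n : ℝ) ≤ 1 → 0 < r →
    ∃ Λ₀ κₑ C₀ : ℝ, 0 < Λ₀ ∧ 0 < κₑ ∧ 0 ≤ C₀ ∧
    ∀ (μc : Fin 4 → ℕ) (V S : Type) [Fintype V] [MeasurableSpace S] (cell : V → CoarseIdx μc)
      (γ₀ γ : Specification V S) (good : CoarseIdx μc → Set (V → S)) (ν₀ ν : Measure (V → S))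
      (p Λl : ℝ),
      (∀ i, 4 * n + 3 ≤ μc i + 1) → IsSpecification γ₀ → IsSpecification γ →
      IsGibbsMeasure γ₀ ν₀ → IsGibbsMeasure γ ν →
      IsGoodFS cell γ₀ good n ε₀ → 0 ≤ Λl → Λl ≤ Λ₀ → HasLeak cell γ₀ n Λl r → HasLeak cell γ n Λl r →
      IsLocallyAC cell γ γ₀ ε₁ → 0 ≤ p → p ≤ p₀ → PeierlsRare good ν₀ p →
      UniformKernelPeierls cell γ₀ good p →
      ∀ (f g : (V → S) → ℝ) (Δf Δg : Finset (CoarseIdx μc)) (Bf Bg : ℝ) (D : ℕ),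
        Measurable f → Measurable g → (∀ σ, |f σ| ≤ Bf) → (∀ σ, |g σ| ≤ Bg) →
        DependsOn f {v | cell v ∈ Δf} → DependsOn g {v | cell v ∈ Δg} →
        (∀ x ∈ Δf, ∀ y ∈ Δg, D ≤ cdist x y) →
          |∫ σ, f σ * g σ ∂ν - (∫ σ, f σ ∂ν) * ∫ σ, g σ ∂ν| ≤
            C₀ * Bf * Bg * Δf.card * Δg.card * Real.exp (-(κₑ * D))

/-- **The annealed engine** (classical, `G`-blind; statement of the OPEN stub `stub_annealedEngine`):
for ONE quasi-local specification on a coarse 4-torus (`≥ 4n+3` cells per side) with the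
good-exterior finite-size condition at `(n, ε)`, `ε·shellCount 4 n ≤ 3/4`, leak `(Λl ≤ Λ₀, r)`
and the kernel-uniform Peierls bound at level `q ≤ q₀(n)`, every Gibbs measure `ν` has averaged
boundary influence `∫ |γ_Λ f - ν f| dν ≤ C |Δf| |Δg| e^{-κₑ D}` for `[0,1]`-valued observables
`f` of the cells `Δf`, `Λ` the sites whose cell is not in `Δg`, `D ≤ cdist(Δf, Δg)` (van den
Berg–Maes disagreement percolation / Dobrushin–Shlosman with Peierls-rare defects; not a textbook
theorem in this form). -/
def AnnealedEngine : Prop :=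
  ∀ n : ℕ, 1 ≤ n → ∃ q₀ : ℝ, 0 < q₀ ∧ ∀ r : ℝ, 0 < r →
    ∃ Λ₀ κₑ C : ℝ, 0 < Λ₀ ∧ 0 < κₑ ∧ 0 ≤ C ∧
    ∀ (μc : Fin 4 → ℕ) (V S : Type) [Fintype V] [MeasurableSpace S] (cell : V → CoarseIdx μc)
      (γ : Specification V S) (good : CoarseIdx μc → Set (V → S)) (ν : Measure (V → S))
      (ε q Λl : ℝ),
      (∀ i, 4 * n + 3 ≤ μc i + 1) → IsSpecification γ → IsGibbsMeasure γ ν →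
      0 ≤ ε → ε * (shellCount 4 n : ℝ) ≤ 3 / 4 → IsGoodFS cell γ good n ε →
      0 ≤ Λl → Λl ≤ Λ₀ → HasLeak cell γ n Λl r →
      0 ≤ q → q ≤ q₀ → UniformKernelPeierls cell γ good q →
      ∀ (f : (V → S) → ℝ) (Δf Δg : Finset (CoarseIdx μc)) (D : ℕ),
        Measurable f → (∀ σ, 0 ≤ f σ ∧ f σ ≤ 1) → DependsOn f {v | cell v ∈ Δf} →
        (∀ x ∈ Δf, ∀ y ∈ Δg, D ≤ cdist x y) →
          ∫ ζ, |∫ σ, f σ ∂(γ (Finset.univ.filter fun v => cell v ∉ Δg) ζ) - ∫ σ, f σ ∂ν| ∂ν ≤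
            C * Δf.card * Δg.card * Real.exp (-(κₑ * D))

/-! ## Proof of `stub_engineOfAnnealed` -/

section Proof

/-- The local-a.c. rate of the engine at window `n`: `ε₁(n) = log(1 + 1/(8·shellCount 4 n))/(4n+1)⁴`,
chosen so that `2(e^{ε₁(4n+1)⁴} - 1)·shellCount 4 n = 1/4`. -/
def epsOne (n : ℕ) : ℝ :=
  Real.log (1 + 1 / (8 * (shellCount 4 n : ℝ))) / (((4 * n + 1) ^ 4 : ℕ) : ℝ)

/-- `shellCount 4 n ≥ 1` as a real number. -/
theorem one_le_shellCount_four (n : ℕ) : (1 : ℝ) ≤ shellCount 4 n := by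
  exact_mod_cast one_le_shellCount (d := 4) n

/-- `ε₁(n) > 0`. -/
theorem epsOne_pos (n : ℕ) : 0 < epsOne n := by
  unfold epsOne
  have hs := one_le_shellCount_four n
  refine div_pos (Real.log_pos ?_) (by positivity)
  have : 0 < 1 / (8 * (shellCount 4 n : ℝ)) := by positivity
  linarith

/-- The perturbed threshold: `2(e^{ε₁(n)(4n+1)⁴} - 1) = 1/(4·shellCount 4 n)`. -/
theorem two_mul_exp_epsOne_sub_one (n : ℕ) :
    2 * (Real.exp (epsOne n * (((4 * n + 1) ^ 4 : ℕ) : ℝ)) - 1) =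
      1 / (4 * (shellCount 4 n : ℝ)) := by
  have hs := one_le_shellCount_four n
  have hpow : (((4 * n + 1) ^ 4 : ℕ) : ℝ) ≠ 0 := by positivity
  have hε : epsOne n * (((4 * n + 1) ^ 4 : ℕ) : ℝ) =
      Real.log (1 + 1 / (8 * (shellCount 4 n : ℝ))) := by
    unfold epsOne
    field_simp
  rw [hε, Real.exp_log (by positivity)]
  field_simp
  ring

/-- **Peierls transfer under the uniform kernel bound** (4-dimensional instance of the Literature
theorem `peierlsRare_of_uniformKernelPeierls`): if the reference specification satisfies
`UniformKernelPeierls cell γ₀ good p` and `γ` is locally a.c. w.r.t. `γ₀` at rate `ε₁ ≥ 0`, then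
every Gibbs measure `ν` of `γ` has `PeierlsRare good ν (e^{81 ε₁} p)`. -/
theorem peierlsTransfer {V S : Type} [MeasurableSpace S] {μc : Fin 4 → ℕ} [Fintype V]
    {cell : V → CoarseIdx μc} {γ γ₀ : Specification V S} (hγ : IsSpecification γ)
    {good : CoarseIdx μc → Set (V → S)} {n : ℕ} {ε₀ p ε₁ : ℝ}
    (hFS : IsGoodFS cell γ₀ good n ε₀) (hp : 0 ≤ p) (hε₁ : 0 ≤ ε₁)
    (hUKP : UniformKernelPeierls cell γ₀ good p) (hAC : IsLocallyAC cell γ γ₀ ε₁)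
    {ν : Measure (V → S)} (hν : IsGibbsMeasure γ ν) :
    PeierlsRare good ν (Real.exp (ε₁ * 3 ^ 4) * p) :=
  peierlsRare_of_uniformKernelPeierls hγ hFS.good_local hFS.good_meas hp hε₁ hUKP hAC hν

/-- **`stub_engineOfAnnealed` (CLOSED)**: the annealed engine implies the engine with the
kernel-uniform Peierls datum. Thresholds `ε₁ = epsOne n` (the perturbed finite-size threshold
`ε = ε₀ + 1/(4·shellCount 4 n)` of `isGoodFS_of_isLocallyAC` has `ε·shellCount ≤ 3/4`) and
`p₀ = q₀ e^{-81 ε₁}` (the perturbed kernels satisfy the uniform Peierls bound at level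
`e^{81ε₁} p ≤ q₀`, `kernel_allBad_le_of_uniformKernelPeierls`); constants `(Λ₀, κₑ, 2C)` of the
annealed engine at leak rate `r`; then `|cov_ν(f,g)| ≤ B_g ∫ |γ_Λ f - ν f| dν` for `Λ :=` the sites
whose cell is not in `Δg` (`abs_covariance_le_integral_abs`), the rescaling of `f` to `[0,1]`
(`integral_abs_kernel_sub_rescale`, factor `2B_f`; `B_f = 0` forces `f = 0`) and the annealed bound. -/
theorem stub_engineOfAnnealed : AnnealedEngine → PerturbedMixingEngineUKP := by
  intro hA n hn
  obtain ⟨q₀, hq₀, hrest⟩ := hA n hn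
  set ε₁ : ℝ := epsOne n with hε₁def
  have hε₁ : 0 < ε₁ := epsOne_pos n
  refine ⟨q₀ * Real.exp (-(ε₁ * 3 ^ 4)), ε₁, by positivity, hε₁, fun ε₀ r hε₀ hε₀s hr => ?_⟩
  obtain ⟨Λ₀, κₑ, C, hΛ₀, hκₑ, hC, hinst⟩ := hrest r hr
  refine ⟨Λ₀, κₑ, 2 * C, hΛ₀, hκₑ, by positivity, ?_⟩
  intro μc V S _ _ cell γ₀ γ good ν₀ ν p Λl hμc hγ₀ hγ hν₀ hν hFS hΛl hΛlΛ₀ hleak₀ hleak hAC hp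
    hpp₀ _hPei hUKP f g Δf Δg Bf Bg D hf hg hfB hgB hfdep hgdep hD
  haveI := hν.isProbabilityMeasure
  -- finite-size condition and uniform kernel Peierls bound for the perturbed specification
  have hFSγ := isGoodFS_of_isLocallyAC hγ hγ₀ hε₁.le hFS hAC
  set ε : ℝ := ε₀ + 2 * (Real.exp (ε₁ * (((4 * n + 1) ^ 4 : ℕ) : ℝ)) - 1) with hεdef
  have hs := one_le_shellCount_four n
  have hε2 : ε = ε₀ + 1 / (4 * (shellCount 4 n : ℝ)) := by
    rw [hεdef, hε₁def, two_mul_exp_epsOne_sub_one]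
  have hε : 0 ≤ ε := by rw [hε2]; positivity
  have hεs : ε * shellCount 4 n ≤ 3 / 4 := by
    have hq : 1 / (4 * (shellCount 4 n : ℝ)) * shellCount 4 n = 1 / 4 := by
      field_simp
    rw [hε2, add_mul, hq]
    linarith
  set q : ℝ := Real.exp (ε₁ * 3 ^ 4) * p with hqdef
  have hq0 : 0 ≤ q := by positivity
  have hqq₀ : q ≤ q₀ := by
    have h := mul_le_mul_of_nonneg_left hpp₀ (Real.exp_pos (ε₁ * 3 ^ 4)).le
    rw [hqdef]
    calc Real.exp (ε₁ * 3 ^ 4) * p ≤ Real.exp (ε₁ * 3 ^ 4) * (q₀ * Real.exp (-(ε₁ * 3 ^ 4))) := h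
      _ = q₀ := by rw [Real.exp_neg]; field_simp
  have hUKPγ : UniformKernelPeierls cell γ good q := fun A hA' ζ D' hD' =>
    kernel_allBad_le_of_uniformKernelPeierls hγ hFS.good_local hFS.good_meas hp hε₁.le hUKP hAC A
      hA' ζ D' hD'
  have hcoref := hinst μc V S cell γ good ν ε q Λl hμc hγ hν hε hεs hFSγ hΛl hΛlΛ₀ hleak hq0 hqq₀
    hUKPγ
  -- covariance ≤ averaged boundary influence, rescaled
  set Λ : Finset V := Finset.univ.filter fun v => cell v ∉ Δg with hΛ
  have hgdep' : DependsOn g ((↑Λ : Set V)ᶜ) := by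
    refine fun σ τ hστ => hgdep fun v hv => hστ v ?_
    intro hvΛ
    exact (Finset.mem_filter.1 (Finset.mem_coe.1 hvΛ)).2 hv
  obtain ⟨σ₀⟩ : Nonempty (V → S) := by
    obtain ⟨σ, -⟩ := nonempty_of_measure_ne_zero (μ := ν) (s := Set.univ) (by simp)
    exact ⟨σ⟩
  have hBf : 0 ≤ Bf := (abs_nonneg _).trans (hfB σ₀)
  have hBg : 0 ≤ Bg := (abs_nonneg _).trans (hgB σ₀)
  have hcov := abs_covariance_le_integral_abs hγ hν Λ hf hg hfB hgB hgdep'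
  have hRHS : 0 ≤ 2 * C * Bf * Bg * Δf.card * Δg.card * Real.exp (-(κₑ * D)) := by positivity
  rcases hBf.eq_or_lt with hBf0 | hBfpos
  · have hf0 : ∀ σ, f σ = 0 := fun σ => abs_nonpos_iff.1 (hBf0 ▸ hfB σ)
    have : ∫ σ, f σ * g σ ∂ν - (∫ σ, f σ ∂ν) * ∫ σ, g σ ∂ν = 0 := by simp [hf0]
    rw [this, abs_zero]
    exact hRHS
  · set f' : (V → S) → ℝ := fun σ => (f σ / Bf + 1) / 2 with hf'
    have hf'm : Measurable f' := ((hf.div_const Bf).add_const 1).div_const 2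
    have hf'01 : ∀ σ, 0 ≤ f' σ ∧ f' σ ≤ 1 := fun σ => by
      have h := hfB σ
      rw [abs_le] at h
      have hlo : -1 ≤ f σ / Bf := by rw [le_div_iff₀ hBfpos]; linarith [h.1]
      have hhi : f σ / Bf ≤ 1 := by rw [div_le_iff₀ hBfpos]; linarith [h.2]
      simp only [hf']
      constructor <;> linarith
    have hf'dep : DependsOn f' {v | cell v ∈ Δf} := fun σ τ hστ => by
      simp only [hf', hfdep hστ]
    have hcore' := hcoref f' Δf Δg D hf'm hf'01 hf'dep hD
    have hresc := integral_abs_kernel_sub_rescale hγ (ν := ν) Λ hf hfB hBfpos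
    calc |∫ σ, f σ * g σ ∂ν - (∫ σ, f σ ∂ν) * ∫ σ, g σ ∂ν|
        ≤ Bg * ∫ ζ, |∫ σ, f σ ∂(γ Λ ζ) - ∫ σ, f σ ∂ν| ∂ν := hcov
      _ = Bg * (2 * Bf * ∫ ζ, |∫ σ, f' σ ∂(γ Λ ζ) - ∫ σ, f' σ ∂ν| ∂ν) := by rw [hresc]
      _ ≤ Bg * (2 * Bf * (C * Δf.card * Δg.card * Real.exp (-(κₑ * D)))) := by gcongr
      _ = 2 * C * Bf * Bg * Δf.card * Δg.card * Real.exp (-(κₑ * D)) := by ring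

end Proof

end Summit.QuantumFields.QCD.Cruxes.RobustYangMills.LocalAcOpenCertificate

end
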